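import Summits.Ventures.AbcSig.Rows.TemplateBC
import Summits.Ventures.AbcSig.Levels.N800
import Summits.Ventures.AbcSig.Levels.N50

/-!
# Venture AbcSig — ROW `Xn8Yn5Z2`: `xⁿ + 8yⁿ = 5 z²` (FAMILY C1b, `α = 3`; GENERATED by p-lean gen3/leanrow_c1b.py)

HONEST FRAMING. A row of a COMPUTATION cell (`pub-abcsig`); a CONDITIONAL theorem, no claim on ABC or any summit.
Hypotheses: `BS04Package` (CITED: [BS04] Lemma 3.3 + (3.1) + Lemma 4.2), `DataComplete` at the levels 800 (`y` odd,
case (iv)₃) and 50 (`y` even, case (v₇)) (COMPUTED, certified level files), and the listed per-orbit exclusions `hX_…`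
(CITED; the row of record's R5 names the printed argument / module for each: [BS04, Prop. 4.6] for the CM orbits,
module M6c CM-congruence certificates). Everything else is kernel-checked (`Rows/TemplateBC.lean`, `Levels/N….lean`).
Exponent range: prime `n ≥ 7`; `x·y ≠ ±1`.
Row of record: `census/rows/C1b/C1b-C5-a3.md` (sha16 `ca87f72db9c15c51`; R8-signed, ref-g20 2026-08-22T23:18:29Z); p1's statement of record: the conjunct `Rows.C1bCell 5 (fun _ α => α = 3) 7 ∅` of `Rows/StatementsC1b.lean` ([BS04, Thm 1.2] small-α completion at C = 5: every prime n ≥ 7). The kernel sieve at levels 800 / 50 leaves no residual exponent ≥ 7; the five rational orbits of level 800 not eliminable by the sieve enter as the named hypotheses `hX_…` (CITED: the row's R3/R5 name [BS04, Prop. 4.4 / 4.6] per orbit).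
-/

namespace Summit.Ventures.AbcSig

/-- Row `Xn8Yn5Z2`: no primitive solution of `xⁿ + 8yⁿ = 5 z²` with `x·y ≠ ±1` for prime `n ≥ 7`,
conditional on the named hypotheses. -/
theorem row_Xn8Yn5Z2 (M : NewformModel) (hP : M.BS04Package)
    (hD800 : M.DataComplete 800 level800Orbits) (hD50 : M.DataComplete 50 level50Orbits)
    (n : ℕ) (hn : n.Prime) (hmin : 7 ≤ n)
    (hX_orbit_800_1 : M.Excludes 800 orbit_800_1 (famBC 3 5 n (fun _ b => ¬ 2 ∣ b)))
    (hX_orbit_800_4 : M.Excludes 800 orbit_800_4 (famBC 3 5 n (fun _ b => ¬ 2 ∣ b)))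
    (hX_orbit_800_5 : M.Excludes 800 orbit_800_5 (famBC 3 5 n (fun _ b => ¬ 2 ∣ b)))
    (hX_orbit_800_6 : M.Excludes 800 orbit_800_6 (famBC 3 5 n (fun _ b => ¬ 2 ∣ b)))
    (hX_orbit_800_9 : M.Excludes 800 orbit_800_9 (famBC 3 5 n (fun _ b => ¬ 2 ∣ b)))
    (x y z : ℤ) (hxy1 : x * y ≠ 1) (hxy2 : x * y ≠ -1) : ¬ IsPrimitiveSolution 1 (2 ^ 3) 5 n x y z := by
  have h7 : 7 ≤ n := by omega
  have hC : Nat.Prime 5 := by norm_num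
  have hsq : Squarefree (5 : ℕ) := (Nat.prime_iff.mp hC).squarefree
  have hnC : ¬ n ∣ 5 := by
    intro h
    rcases (Nat.dvd_prime hC).mp h with h1 | h1 <;> omega
  by_cases hy : 2 ∣ y
  · exact branchBC_v7 3 5 hsq (by decide) M hP hD50 n hn h7 hnC (by omega)
      (level50_sieve n hn h7 (fun o => M.Excludes 50 o
      (famBC 3 5 n (fun _ b => 2 ∣ b))))
      x y z hy hxy1 hxy2
  · exact branchBC_iv3 5 hsq (by decide) M hP hD800 n hn h7 hnC
      (level800_sieve n hn h7 (fun o => M.Excludes 800 o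
      (famBC 3 5 n (fun _ b => ¬ 2 ∣ b))) hX_orbit_800_1 hX_orbit_800_4 hX_orbit_800_5 hX_orbit_800_6 hX_orbit_800_9)
      x y z hy hxy1 hxy2

end Summit.Ventures.AbcSig
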